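import Literature.Topology.FourManifolds.SurfaceGroupNielsenSetup
import Literature.GroupTheory.CombinatorialGroupTheory.FreeGroupAmalgamSeparation
import HarnessLib

/-!
# Nielsen's lifting theorem after Zieschang: the block lemma (pillar A3)

Topic `Literature/Topology/FourManifolds`.  Pillar `(A3)` of the algebraic proof of Nielsen's
theorem set up in `SurfaceGroupNielsenSetup.lean` (`BlockLemma`, ZVC LNM 835, Thm. 5.3.6: *the
canonical binary product is indecomposable*): for an automorphism `ψ` of the free group
`F = F⟨a, b⟩` carrying an alternating quadratic word `w = A P B` exactly onto the relator
`r_g = ∏ [aᵢ, bᵢ]`, and a non-empty proper block `P` of `w` closed under partner letters (no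
symbol of `P` occurs in `A` or `B`), the value `ψ (mk P)` is non-trivial in `S_g = F / ⟪r_g⟫`
(`blockLemma_holds`).  Geometrically `w` is the boundary word of a one-vertex dissection of the
closed orientable surface of genus `g` and the boundary curve of the sub-dissection `P` cuts the
surface into two pieces of positive genus, so it is essential; the proof here is purely
algebraic:

* pulling back along `ψ`, the claim is `p ∉ ⟪p · (b a)⟫` for `a = mk A`, `p = mk P`, `b = mk B`
  (`⟪a p b⟫ = ⟪p b a⟫`);
* `p ≠ 1` and `b a ≠ 1`: the intersection form of `w` is nondegenerate (it is carried by `ψ`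
  to the standard symplectic form of `r_g`, `Nondeg.transport`, `nondeg_surfaceWordStd` of
  `QuadraticWordsForm.lean`), but if `p = 1` (resp. `a b = 1`) the indicator weight of a symbol
  of `P` (resp. of `A B`) would lie in its radical (`mk_ne_one_of_block`,
  `mk_ne_one_of_coblock`);
* words `p ≠ 1`, `q ≠ 1` on disjoint alphabets are never identified by the single relation
  `p q`: map `F` onto the amalgam `F *_ℤ F` (`mk_notMem_normalClosure_mk_mul_mk` of
  `FreeGroupAmalgamSeparation.lean`).

## References

* H. Zieschang, E. Vogt, H.-D. Coldewey, *Surfaces and Planar Discontinuous Groups*, LNM 835,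
  Springer (1980), §5.3 (5.3.1 (b), Thm. 5.3.6), §3.6 (3.6.1–3.6.3). [ZieschangVogtColdewey1980]
-/

noncomputable section

namespace Literature.Topology.FourManifolds

open Literature.GroupTheory.CombinatorialGroupTheory List

namespace SurfaceGroup

variable {g : ℕ}

/-! ## Nondegeneracy consequences for a marked quadratic word -/

/-- The word `A P B` of a marking has nondegenerate intersection form: `ψ` carries it onto the
relator, whose form is the standard symplectic form. [cite: ZieschangVogtColdewey1980, 3.6.3 (b)] -/
theorem nondeg_of_marking (ψ : FreeGroup (surfaceGen g) ≃* FreeGroup (surfaceGen g))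
    {w : List (surfaceGen g × Bool)} (hψ : ψ (FreeGroup.mk w) = surfaceRelator g) : Nondeg w :=
  (nondeg_surfaceWordStd g).transport (isQuadratic_surfaceWordStd g).isBalanced ψ 1
    (by rw [mk_surfaceWordStd, hψ, one_mul, inv_one, mul_one])

/-- The indicator weight of a symbol is nonzero. [folklore] -/
private theorem single_ne_zero (s : surfaceGen g) : (Pi.single s (1 : ℤ) : surfaceGen g → ℤ) ≠ 0 :=
  fun h0 => by simpa using congrFun h0 s

/-- **A symbol-closed non-empty block of a word with nondegenerate form is non-trivial**: if
`mk P = 1` then `mk (A P B) = mk (A B)` avoids the symbols of `P`, so the indicator weight of a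
symbol of `P` is in the radical of the form. [cite: ZieschangVogtColdewey1980, Thm. 5.3.6 (proof)] -/
theorem mk_ne_one_of_block {A P B : List (surfaceGen g × Bool)} (hN : Nondeg (A ++ P ++ B))
    (hdisj : ∀ x ∈ P, ∀ y ∈ A ++ B, x.1 ≠ y.1) (hP : P ≠ []) : FreeGroup.mk P ≠ 1 := by
  intro h1
  obtain ⟨x₀, hx₀⟩ := List.exists_mem_of_ne_nil P hP
  obtain ⟨η, hη⟩ := hN _ (single_ne_zero x₀.1)
  apply hη
  rw [mk_append, mk_append, h1, mul_one, ← mk_append, omega_mk]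
  exact omegaW_eq_zero_of_forall fun y hy => Pi.single_eq_of_ne (hdisj x₀ hx₀ y hy).symm _

/-- A symbol-closed block of a quadratic word is balanced (it contains both letters of each of
its symbols). [folklore] -/
theorem isBalanced_block {ι : Type*} [DecidableEq ι] {A P B : List (ι × Bool)}
    (hq : IsQuadratic (A ++ P ++ B)) (hdisj : ∀ x ∈ P, ∀ y ∈ A ++ B, x.1 ≠ y.1) :
    IsBalanced P := by
  intro i
  have hqi := (hq i).1
  simp only [List.count_append] at hqi
  by_cases hi : ∃ x ∈ P, x.1 = i
  · obtain ⟨x, hxP, rfl⟩ := hi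
    have hA : ∀ s, List.count (x.1, s) A = 0 := fun s =>
      List.count_eq_zero.2 fun hm => hdisj x hxP _ (List.mem_append_left _ hm) rfl
    have hB : ∀ s, List.count (x.1, s) B = 0 := fun s =>
      List.count_eq_zero.2 fun hm => hdisj x hxP _ (List.mem_append_right _ hm) rfl
    rw [hA, hA, hB, hB] at hqi
    simpa using hqi
  · push Not at hi
    rw [List.count_eq_zero.2 fun hm => hi (i, true) hm rfl,
      List.count_eq_zero.2 fun hm => hi (i, false) hm rfl]

/-- **The complement of a symbol-closed proper block of a quadratic word with nondegenerate form
is non-trivial**: if `mk (A B) = 1` then `mk (A P B) = a · p · a⁻¹` with `p = mk P` balanced and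
avoiding the symbols of `A B`, so the indicator weight of a symbol of `A B` is in the radical of
the form. [cite: ZieschangVogtColdewey1980, Thm. 5.3.6 (proof)] -/
theorem mk_ne_one_of_coblock {A P B : List (surfaceGen g × Bool)} (hN : Nondeg (A ++ P ++ B))
    (hq : IsQuadratic (A ++ P ++ B)) (hdisj : ∀ x ∈ P, ∀ y ∈ A ++ B, x.1 ≠ y.1) (hAB : A ++ B ≠ []) :
    FreeGroup.mk (B ++ A) ≠ 1 := by
  intro h1
  have hB : FreeGroup.mk B = (FreeGroup.mk A)⁻¹ := eq_inv_of_mul_eq_one_left (by rwa [← mk_append])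
  obtain ⟨y₀, hy₀⟩ := List.exists_mem_of_ne_nil (A ++ B) hAB
  obtain ⟨η, hη⟩ := hN _ (single_ne_zero y₀.1)
  apply hη
  have hvan : ∀ x ∈ P, (Pi.single y₀.1 (1 : ℤ) : surfaceGen g → ℤ) x.1 = 0 :=
    fun x hx => Pi.single_eq_of_ne (hdisj x hx y₀ hy₀) _
  rw [omega, mk_append, mk_append, hB, map_mul, map_mul, map_inv, heisHom_mk_of_vanish η hvan,
    (isBalanced_block hq hdisj).lsum_eq_zero]
  exact Heis.conj_c _ _ rfl rfl

/-! ## The block lemma -/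

/-- Pulling a membership `ψ x ∈ ⟪r_g⟫` back along a marking `ψ` of `w = A P B`:
`x ∈ ⟪mk P · mk (B A)⟫` (the normal closures of `mk (A P B)` and of its rotation `mk (P B A)`
agree). [folklore] -/
theorem mem_normalClosure_of_marking (ψ : FreeGroup (surfaceGen g) ≃* FreeGroup (surfaceGen g))
    {A P B : List (surfaceGen g × Bool)} (hψ : ψ (FreeGroup.mk (A ++ P ++ B)) = surfaceRelator g)
    {x : FreeGroup (surfaceGen g)}
    (hx : ψ x ∈ Subgroup.normalClosure ({surfaceRelator g} : Set (FreeGroup (surfaceGen g)))) :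
    x ∈ Subgroup.normalClosure
      ({FreeGroup.mk P * FreeGroup.mk (B ++ A)} : Set (FreeGroup (surfaceGen g))) := by
  set N := Subgroup.normalClosure
    ({FreeGroup.mk P * FreeGroup.mk (B ++ A)} : Set (FreeGroup (surfaceGen g)))
  have hle : Subgroup.normalClosure ({surfaceRelator g} : Set (FreeGroup (surfaceGen g))) ≤
      N.comap (ψ.symm : FreeGroup (surfaceGen g) →* FreeGroup (surfaceGen g)) := by
    refine Subgroup.normalClosure_le_normal ?_
    rintro _ rfl
    rw [SetLike.mem_coe, Subgroup.mem_comap, MonoidHom.coe_coe, ← hψ,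
      MulEquiv.symm_apply_apply]
    have e : FreeGroup.mk (A ++ P ++ B) =
        FreeGroup.mk A * (FreeGroup.mk P * FreeGroup.mk (B ++ A)) * (FreeGroup.mk A)⁻¹ := by
      simp only [mk_append]; group
    rw [e]
    exact (inferInstance : N.Normal).conj_mem _ (Subgroup.subset_normalClosure rfl) _
  have h := hle hx
  rwa [Subgroup.mem_comap, MonoidHom.coe_coe, MulEquiv.symm_apply_apply] at h

/-- **(A3) The block lemma** (ZVC Thm. 5.3.6: the canonical binary product is indecomposable): for
every marking `ψ` of an alternating quadratic word `A P B` (`ψ (mk (A P B)) = r_g`) and every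
non-empty proper symbol-closed block `P`, `ψ (mk P) ≠ 1` in `S_g`.  Proof: by nondegeneracy of
the intersection form `mk P ≠ 1` and `mk (B A) ≠ 1`; these are words on disjoint alphabets, so
`mk P ∉ ⟪mk P · mk (B A)⟫ = ψ⁻¹ ⟪r_g⟫` by the amalgam `F *_ℤ F`.
[cite: ZieschangVogtColdewey1980, Thm. 5.3.6] -/
theorem blockLemma_holds (g : ℕ) : BlockLemma g := by
  intro ψ A P B hψ hq hdisj hP hAB hproj
  have hN : Nondeg (A ++ P ++ B) := nondeg_of_marking ψ hψ
  have hP1 : FreeGroup.mk P ≠ 1 := mk_ne_one_of_block hN hdisj hP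
  have hBA1 : FreeGroup.mk (B ++ A) ≠ 1 := mk_ne_one_of_coblock hN hq hdisj hAB
  have hmem : ψ (FreeGroup.mk P) ∈
      Subgroup.normalClosure ({surfaceRelator g} : Set (FreeGroup (surfaceGen g))) :=
    (mem_ker_proj_iff _).1 ((MonoidHom.mem_ker).2 hproj)
  refine mk_notMem_normalClosure_mk_mul_mk (fun s => ∃ x ∈ P, x.1 = s) (fun x hx => ⟨x, hx, rfl⟩)
    (fun y hy ⟨x, hx, hxy⟩ => hdisj x hx y ?_ hxy) hP1 hBA1 (mem_normalClosure_of_marking ψ hψ hmem)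
  rw [List.mem_append] at hy ⊢
  exact hy.symm

end SurfaceGroup

end Literature.Topology.FourManifolds

end
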